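import Summits.CriticalPhenomena.CardyFormulaZ2.Theorems.CardyComplexConeDefs
import Summits.CriticalPhenomena.CardyFormulaZ2.Theorems.CardyComplexConeCoherentMoreraTraceIdentityAux
import Summits.CriticalPhenomena.CardyFormulaZ2.Theorems.CardySusyWardParafermionPrecompactFourDartSplit
import Summits.CriticalPhenomena.CardyFormulaZ2.Theorems.CardyComplexConeEdgePrecompactShiftCouplingLocalityReduction
import Literature.Probability.LatticeModels.DartPhase
import Literature.Probability.LatticeModels.MedialWindingBridge

/-!
# Stub `stub_traceIdentity` of line `finitary-green-pairing`
(crux `CoherentMorera`, stmt-CriticalPhenomena-11388)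

**The trace identity in expectation, eventually on compacts.** For a guarded family `Λ` of the
Dobrushin domain `D` (`Guards D Λ`: `(Λ δ).Ω = D`, mesh `δ`, eventually admissible) and a compact
`K ⊆ D`: eventually as `δ → 0⁺`, at every lattice edge `s(x, x + eᵢ)` whose medial point lies in
`K`, `2cos(π/12) · F_δ(s(x, x + eᵢ)) = Σ_{k : Fin 4} E_δ(cornersAt x i k)` — the spin-`1/3` vertex
observable `vertexObs` is `(2cos(π/12))⁻¹` times the sum of the corner observables `cornerObs` at
the four corners of the medial vertex (Smirnov 2010, §2.2; Duminil-Copin–Smirnov 2012, §8.3.1).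

Proof (`stub_traceIdentity`).
1. *Pathwise* (`TraceIdentity.pathwise`): the landed four-dart split
   `fourDart_split_medialExploration` of `…CardySusyWardParafermionPrecompactFourDartSplit` gives,
   for `δ ≠ 0` and a lattice edge that is not an `A`–`B` edge of the datum,
   `2cos(π/12) · passageSum γ δ (1/3) s(x, x + eᵢ) = Σ_q dartPhaseSum γ δ (1/3) (class-q corner)`,
   `γ = medialExploration (Λ δ) ω`; the class-indexed corners of that file and our clockwise table
   `cornersAt x i` are the same four corners (`TraceIdentity.sum_pivot_eq_sum_cornersAt`), and the
   crux integrand `cornerPhase` is `dartPhaseSum` (`TraceIdentity.cornerPhase_eq`).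
2. *Geometry* (landed helper `medialPoint_far_not_mem_zdABEdges` of
   `…CardyComplexConeCoherentMoreraTraceIdentityAux`): a lattice edge whose closed `2δ`-ball about
   its midpoint lies in `(Λ δ).Ω = D` is not an `A`–`B` edge. With `ρ > 0` such that
   `cthickening ρ K ⊆ D` (`IsCompact.exists_cthickening_subset_open`), this holds for every edge
   with medial point in `K` as soon as `2δ ≤ ρ`.
3. *Expectation*: for admissible `Λ δ` the four integrands are integrable
   (`integrable_dartPhaseSum_medialExploration`), so the pathwise identity integrates term by term
   (`integral_const_mul`, `integral_finsetSum`). The eventuality is `{δ admissible} ∩ (0, ρ/2]`.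
-/

namespace Summit.CriticalPhenomena.CardyFormulaZ2.Cruxes.CoherentMorera.FinitaryGreenPairing

open MeasureTheory Filter Set Metric
open scoped Topology BigOperators
open Literature.Probability.LatticeModels
open Literature.Probability.Percolation (BondConfig bondPercolation half)
open Literature.Probability.RandomPlanarGeometry (DobrushinDomain)
open Summit.CriticalPhenomena.CardyFormulaZ2.Cruxes.ParafermionPrecompact.KenyonStreamSecondRelation
  (ex classOffset pivotOf mv fourDart_split_medialExploration sum_classes_eq)

noncomputable section

namespace TraceIdentity

/-! ## The four corners at a medial vertex -/

/-- The class-indexed corners `(pivotOf x i q, pivotOf x i q + classOffset q)` of the sibling line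
`kenyon-stream-second-relation` and the clockwise table `cornersAt x i` list the same four corners
(identically for a horizontal edge, shifted by two places for a vertical one), so sums agree. -/
theorem sum_pivot_eq_sum_cornersAt (Φ : Site 2 × Site 2 → ℂ) (x : Site 2) (i : Fin 2) :
    ∑ q : Fin 4, Φ (pivotOf x i q, pivotOf x i q + classOffset q) =
      ∑ k : Fin 4, Φ (cornersAt x i k) := by
  have key : ∀ v w v' w' : Site 2, (∀ j, v j = v' j) → (∀ j, w j = w' j) →
      Φ (v, w) = Φ (v', w') := fun v w v' w' hv hw => by rw [funext hv, funext hw]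
  fin_cases i
  · refine Fintype.sum_congr _ _ fun q => ?_
    fin_cases q <;>
      exact key _ _ _ _ (fun j => by fin_cases j <;> simp [pivotOf, ex])
        (fun j => by fin_cases j <;> simp [pivotOf, classOffset, ex] <;> omega)
  · refine Fintype.sum_equiv (Equiv.addRight 2) _ _ fun q => ?_
    fin_cases q <;>
      exact key _ _ _ _ (fun j => by fin_cases j <;> simp [pivotOf, ex])
        (fun j => by fin_cases j <;> simp [pivotOf, classOffset, ex] <;> omega)

/-! ## The integrand -/

/-- The crux integrand `cornerPhase` is the named dart phase sum of `DartPhase.lean` (exponent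
`-(i/3)·W` versus `-i·(1/3)·W`). -/
theorem cornerPhase_eq (δ : ℝ) (E : DiscreteDobrushin) (c : Site 2 × Site 2)
    (ω : BondConfig (Site 2)) :
    cornerPhase δ E c.1 c.2 ω = Parafermion.dartPhaseSum (medialExploration E ω) δ (1 / 3) c := by
  unfold cornerPhase Parafermion.dartPhaseSum -- buildfix 2026-08-20: two `winding` copies, bridge them:
  rw [Literature.Probability.LatticeModels.Polyline.winding_eq_winding']; refine Finset.sum_congr rfl fun k _ => ?_
  congr 1
  push_cast
  ring

/-- **The pathwise trace identity**: for `δ ≠ 0`, every configuration `ω` and every lattice edge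
`mv (x, i) = s(x, x + eᵢ)` that is not an `A`–`B` edge of `E`,
`2cos(π/12) · passageSum γ δ (1/3) s(x, x + eᵢ) = Σ_k cornerPhase δ E (cornersAt x i k) ω`,
`γ = medialExploration E ω` (the landed four-dart split, re-indexed by `cornersAt`). -/
theorem pathwise {E : DiscreteDobrushin} {δ : ℝ} (hδ : δ ≠ 0) (ω : BondConfig (Site 2)) (x : Site 2)
    (i : Fin 2) (hz : mv (x, i) ∉ E.zdABEdges) :
    ((2 * Real.cos (Real.pi / 12) : ℝ) : ℂ) *
        MedialPath.passageSum (medialExploration E ω) δ (1 / 3) (mv (x, i)) =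
      ∑ k : Fin 4, cornerPhase δ E (cornersAt x i k).1 (cornersAt x i k).2 ω := by
  rw [fourDart_split_medialExploration E δ hδ ω x i hz, sum_pivot_eq_sum_cornersAt]
  simp only [cornerPhase_eq]

end TraceIdentity

open TraceIdentity in
/-- STUB `stub_traceIdentity` — **the trace identity in expectation, eventually on compacts**: for a
guarded family `Λ` of the Dobrushin domain `D` and a compact `K ⊆ D`, eventually as `δ → 0⁺`, at
every lattice edge `s(x, x + eᵢ)` with medial point in `K`,
`2cos(π/12) · F_δ(s(x, x + eᵢ)) = Σ_k E_δ(cornersAt x i k)`. Proof: take `ρ > 0` with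
`cthickening ρ K ⊆ D`; for admissible `0 < δ ≤ ρ/2` the closed `2δ`-ball about a medial point of `K`
lies in `D = (Λ δ).Ω`, so the edge is not an `A`–`B` edge (`medialPoint_far_not_mem_zdABEdges`) and
the pathwise identity (`TraceIdentity.pathwise`) integrates term by term
(`integrable_dartPhaseSum_medialExploration`). -/
theorem stub_traceIdentity : Sig.stub_traceIdentity := by
  rintro D Λ ⟨hΩ, hΛδ, hadm⟩ K hK hKD
  obtain ⟨ρ, hρ, hρD⟩ := hK.exists_cthickening_subset_open D.isOpen hKD
  have hsmall : ∀ᶠ δ in 𝓝[>] (0:ℝ), δ ∈ Set.Ioc 0 (ρ / 2) := Ioc_mem_nhdsGT (by positivity)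
  filter_upwards [hadm, hsmall] with δ hE hδI x i hxK
  obtain ⟨hδ0, hδρ⟩ := hδI
  -- the edge is `2δ`-deep in `D = (Λ δ).Ω`, hence not an `A`–`B` edge
  have hz : mv (x, i) ∉ (Λ δ).zdABEdges := by
    refine medialPoint_far_not_mem_zdABEdges (Λ δ) (by rw [hΛδ]; exact hδ0.le) x i ?_
    rw [hΛδ, hΩ]
    intro p hp
    exact hρD (mem_cthickening_of_dist_le p _ ρ K hxK ((mem_closedBall.1 hp).trans (by linarith)))
  -- the four corner integrands are integrable (admissible datum)
  have hI : ∀ k : Fin 4, Integrable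
      (fun ω => cornerPhase δ (Λ δ) (cornersAt x i k).1 (cornersAt x i k).2 ω)
      (bondPercolation (zdGraph 2) half) := fun k => by
    simp only [cornerPhase_eq]
    exact Cruxes.EdgePrecompact.QkzStripBoundaryArm.integrable_dartPhaseSum_medialExploration
      hE δ (1 / 3) _
  -- integrate the pathwise identity
  show _ * vertexObs Λ δ (mv (x, i)) = _
  simp only [vertexObs, cornerObs]
  rw [← integral_const_mul, ← integral_finsetSum _ fun k _ => hI k]
  exact integral_congr_ae (Eventually.of_forall fun ω => pathwise hδ0.ne' ω x i hz)

end

end Summit.CriticalPhenomena.CardyFormulaZ2.Cruxes.CoherentMorera.FinitaryGreenPairing
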